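import Summits.QuantumFields.BalabanUV.Beta.WardLocusInduction
import Summits.QuantumFields.BalabanUV.Beta.ValueJetGeneric
import Summits.QuantumFields.BalabanUV.Beta.KernelWardLevels

/-!
# `BalabanUV.Beta.WardLocusRecursive` — binder row D1, the WARD binder hW: A RECURSIVELY-TYPED CANDIDATE STEP FAMILY `SrecAt`
# (objects BESIDE the spine, NOT the wall literal) whose first-order Ward socket `hSd` holds AT EVERY LEVEL at the pinned units

HONEST FRAMING (cell charter, verbatim): «discharging `BetaPertH` makes Bałaban's UV stability UNCONDITIONAL — a real constructive-QFT
result; it is NOT the continuum limit and NOT the Clay problem.»  DERIVED cell leaf (pub-balaban β sub-cell, D1 formalisation swarm seat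
`b2b-balaban-beta-d1-formalise-leaf-10`, gen 2; sequel of `WardLocusInduction` p210905); kernel algebra over objects ALREADY in the tree, cited
BY NAME, plus ONE data definition (`SrecAt`, a candidate object in this module's namespace, like an2's gen-14 `ScNAt`/`SstepNAt` beside
`Sc`/`Sstep`); no statement of Bałaban's papers is typed, no `[cite:]` tag, no `def … : Prop`; it does NOT name, replace or pre-empt the wall
literal `SpineRooted.JsBalBmNAtOf` (ruling (R45)) and instantiates NO binder of the β-function wall.  NOT `BetaPertH`, NOT continuum, NOT Clay.
HONEST DEPENDENCY (cell records, verbatim): «continuum YM on T⁴ ⇐ BetaPertH ∧ nine spine estimates (0/9 proved); BetaPertH ⇐ (D1) ∧ (D4) ∧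
CAP+tail; G-an2-4 gates asym, D1 and NE2/3/4.»
ABSOLUTE RULE (cell charter, verbatim): «No internally-minted statement may enter as a cited fact. Every hypothesis is either kernel-proved in
this package or a verbatim quotation of a PUBLISHED theorem with page reference. The manuscript(s) under audit are NOT citable for their own
disputed steps — they are the thing under adjudication; programme-internal (2001/route/tribunal) claims are never citable.»

WHAT IS HERE.  an2's native step family `SpineRooted.SstepNAt ρ cE cVH cΛ (j+1)` types its cubic sector as the ONE-SHOT STRAIGHT value-function
jet `e3NAtOf (j+1) = e3OfK (Lc^{j+1}) (KInv (Lc^{j+1})) (ScNAt ρ j)` (an2 `ValueJetGeneric.e3NAtOf_eq_e3OfK`), whose level-1 reflection socket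
an3-g29's toy found unfillable (owner DECISION (L3-D), GAP C-an2-75: re-type over the co-dressed resolvent).  §1 defines the RECURSIVE candidate
`SrecAt ρ cE cVH cΛ : ℕ → stencil family`: member `0` = the rooted native spine `S0NAt ρ cE cVH cΛ`; member `j+1` = `SstepNAt (j+1)` with ONLY
the cubic sector re-typed as `e3OfK Lc G_j (SrecAt j)` — the member-`j` stencil dressed by the ℋ-columns of the step-`j` wall propagator
`G_j := coDressKBmAt ρ Lc (KInvStep Lc j)` and sandwiched by it, `mm`-read at blocking `Lc` (B12's inductive definition of the next cubic
vertex) — border and Λ sectors verbatim an2's.  §2: every member is a local stencil family (`locStencil_SrecAt`, an2's `locStencil_e3OfK`) and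
block-translation covariant (`SrecAt_translate`, an2's `e3OfK_translate`).  §3: the divergence of member `j+1` has exactly a cubic and a border
sector (`divV_SrecAt_succ` — the recursion hypothesis `hT` of `WardLocusInduction.hSd_wall_all_S0NAt`; Λ-null by leaf-10's
`WardLocusStep.divV_SLam_lamCoeffK_E2_eq_zero`).  §4 **`hSd_SrecAt`**: at the units PINNED by `WardLocusInduction.stepLocks_bcj_iff` on the hR
hyperplane — `cE = Lc^{d+1}`, `cVH = −cE·Lc^{d+1}/2` — and for EVERY Λ-weight, in-block root, `d`, `Lc ≥ 1`, the hW root's first-order socket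
holds AT EVERY LEVEL with leaf-07's `cH j = (stepScale j·Lc^{d+1})⁻¹`, the step Hessians `bhKStepAt`, and the CONSTANT generator scale `1/2`:
`∀ j y, cH j • Σ_{v ∈ box} divV (SrecAt … j) (Lc•y + v) = conjV (bhKStepAt d ρ Lc j) (diagK ((1/2) • Σ_v legInd ρ (Lc•y + v)))` — NO hypothesis
left (`hX` by an1-g26's `KernelWardLevels.loc_diagK_smul_sum_legInd`).  So a Bałaban-shaped step family passing the Ward socket at all levels
EXISTS in the tree's vocabulary; which normalisation is Bałaban's (this pin, or an2's `wE` re-pin at `cE = 2`, `stepLocks_two_iff`) is the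
units owners' ruling ((R45), C-an2-75(b)).  The REFLECTION socket of `SrecAt` at `j ≥ 1` is NOT claimed here (an3's `VertexSandwichTransport`
+ an3-g30's level-1 contact evaluation read level-generically would give it by the same recursion).
-/

noncomputable section

open Finset
open scoped BigOperators
open Literature.MathematicalPhysics.QuantumFieldTheory
open Literature.MathematicalPhysics.QuantumFieldTheory.Balaban1983to89
open Literature.MathematicalPhysics.QuantumFieldTheory.Balaban1983to89.Beta
open B12Sec2to5 (l1 l1_nonneg)
open ExpKernelCalculus (MKer Decays BiLoc VertexFamily comp shiftK Zl Zl_nonneg)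
open OneStepResolventKernel (Fib KInv LocStencil decays_mono biLoc_mono)
open OneStepKernelFamily (KInvStep decays_KInvStep shiftK_KInvStep)
open KernelWard (divV)
open AffineAveraging (box toSite)
open AveragingHessianKernels (ell)
open AveragingHessianKernelsRooted (vhSAt locStencil_vhSAt vhSAt_translate hessFFAt biLoc_hessFFAt hessFFAt_translate)
open InterLevelTransport (SLam locStencil_SLam SLam_translate)
open BalabanStepJets (locStencil_mono)
open StepJetData (locStencil_add locStencil_smul)
open BalabanStepJetsSucc (mmRead E2 decays_E2 lamCoeffK abs_lamCoeffK_le lamCoeffK_translate shiftK_E2 wE wVH wΛ)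
open Summit.QuantumFields.BalabanUV.Beta.TameKernelCalculus
open Summit.QuantumFields.BalabanUV.Beta.ChartConjugation (conjV)
open Summit.QuantumFields.BalabanUV.Beta.AxialDressingRooted (coDressKBmAt decays_coDressKBmAt_KInvStep shiftK_coDressKBmAt_KInvStep)
open Summit.QuantumFields.BalabanUV.Beta.BorderedHessian (bhKAt bhKStepAt stepScale stepScale_ne_zero diagK)
open Summit.QuantumFields.BalabanUV.Beta.AveragingWardRootedStencils (legInd)
open Summit.QuantumFields.BalabanUV.Beta.SpineRooted (S0NAt locStencil_S0NAt S0NAt_translate e3OfK e3OfK_apply locStencil_e3OfK e3OfK_translate)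
open Summit.QuantumFields.BalabanUV.Beta.WardLocusStencils (divV_apply)
open Summit.QuantumFields.BalabanUV.Beta.WardLocusStep (divV_SLam_lamCoeffK_E2_eq_zero)
open Summit.QuantumFields.BalabanUV.Beta.WardLocusCubic (e3K)
open Summit.QuantumFields.BalabanUV.Beta.WardLocusInduction (hSd_wall_all_S0NAt stepLocks_bcj_iff)
open Summit.QuantumFields.BalabanUV.Beta.KernelWardLevels (loc_diagK_smul_sum_legInd stepScale_zero)

namespace Summit.QuantumFields.BalabanUV.Beta.WardLocusRecursive

variable {d : ℕ}

/-! ## §1 The recursively-typed candidate step family -/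

section Defs

variable (d) (Lc : ℕ) [NeZero Lc]

/-- [our object — a CANDIDATE beside the spine, NOT the wall literal] **THE RECURSIVELY-TYPED STEP STENCIL FAMILY** `SrecAt ρ cE cVH cΛ`:
member `0` is the rooted native spine `S0NAt ρ cE cVH cΛ`; member `j+1` is an2's `SstepNAt ρ cE cVH cΛ (j+1)` with the cubic sector re-typed
as `e3OfK Lc G_j (SrecAt ρ … j)`, `G_j = coDressKBmAt ρ Lc (KInvStep Lc j)` (the step-`j` wall propagator), the border sector `vhSAt ρ` and the
Λ sector `SLam Lc (lamCoeffK (KInvStep Lc (j+1)) (E2 d Lc (j+1)) Lc) (hessFFAt ρ)` with the weights `cE·wE`, `cVH·wVH`, `cΛ·wΛ` verbatim. -/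
def SrecAt (ρ : Fin (d + 1) → ℤ) (cE cVH cΛ : ℝ) : ℕ → Fin (d + 1) → (Fin (d + 1) → ℤ) → MKer (d + 1) (Fib d)
  | 0 => S0NAt d Lc ρ cE cVH cΛ
  | j + 1 => fun κ' u' =>
      (cE * wE d Lc (j + 1)) • e3OfK Lc (coDressKBmAt ρ Lc (KInvStep (d := d) Lc j)) (SrecAt ρ cE cVH cΛ j) κ' u' +
        (cVH * wVH d Lc (j + 1)) • vhSAt ρ d Lc rfl κ' u' +
        (cΛ * wΛ d Lc (j + 1)) • SLam Lc (lamCoeffK (KInvStep (d := d) Lc (j + 1)) (E2 d Lc (j + 1)) Lc) (fun μ y => hessFFAt ρ Lc μ y) κ' u'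

variable {d Lc}

/-- [folklore] Member `0` is the rooted native spine. -/
@[simp] theorem SrecAt_zero (ρ : Fin (d + 1) → ℤ) (cE cVH cΛ : ℝ) : SrecAt d Lc ρ cE cVH cΛ 0 = S0NAt d Lc ρ cE cVH cΛ := rfl

/-- [folklore] The recursion step (unfolding lemma). -/
theorem SrecAt_succ (ρ : Fin (d + 1) → ℤ) (cE cVH cΛ : ℝ) (j : ℕ) :
    SrecAt d Lc ρ cE cVH cΛ (j + 1) = fun κ' u' =>
      (cE * wE d Lc (j + 1)) • e3OfK Lc (coDressKBmAt ρ Lc (KInvStep (d := d) Lc j)) (SrecAt d Lc ρ cE cVH cΛ j) κ' u' +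
        (cVH * wVH d Lc (j + 1)) • vhSAt ρ d Lc rfl κ' u' +
        (cΛ * wΛ d Lc (j + 1)) •
          SLam Lc (lamCoeffK (KInvStep (d := d) Lc (j + 1)) (E2 d Lc (j + 1)) Lc) (fun μ y => hessFFAt ρ Lc μ y) κ' u' := rfl

/-- [folklore] an2's `e3OfK N K S` IS leaf-10's `WardLocusCubic.e3K K N S` (same term, argument order). -/
theorem e3OfK_eq_e3K (N : ℕ) (K : MKer (d + 1) (Fib d)) (S : Fin (d + 1) → (Fin (d + 1) → ℤ) → MKer (d + 1) (Fib d)) :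
    e3OfK N K S = e3K K N S := by
  funext κ' u' x' z' a b
  rw [e3OfK_apply]
  rfl

end Defs

/-! ## §2 Locality and block-translation covariance of every member -/

section Local

variable {Lc : ℕ} [NeZero Lc]

/-- [folklore] **EVERY MEMBER OF `SrecAt (toSite r)` IS A LOCAL STENCIL FAMILY** (in-block root; rate existential per level): member `0` by
`locStencil_S0NAt`, member `j+1` by an2's `locStencil_e3OfK` (decay of `G_j`: `decays_coDressKBmAt_KInvStep`) + the border and Λ parts exactly as
in `SpineRooted.locStencil_SstepNAt`. -/
theorem locStencil_SrecAt (hLc : 1 ≤ Lc) {r : Fin (d + 1) → ℕ} (hr : r ∈ box (d + 1) Lc) (cE cVH cΛ : ℝ) :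
    ∀ j : ℕ, ∃ Cs δ : ℝ, 0 < δ ∧ LocStencil (SrecAt d Lc (toSite r) cE cVH cΛ j) Cs δ
  | 0 => locStencil_S0NAt hLc hr cE cVH cΛ
  | j + 1 => by
    obtain ⟨Cs, δs, hδs, hS⟩ := locStencil_SrecAt hLc hr cE cVH cΛ j
    obtain ⟨C₁, δ₁, hδ₁, h1⟩ := locStencil_e3OfK (N := Lc) hLc (decays_coDressKBmAt_KInvStep (d := d) hr j) hS hδs
    obtain ⟨δA, CA, hδA, hCA, hA⟩ := decays_KInvStep (Lc := Lc) (d := d) (j + 1)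
    obtain ⟨δE, CE, hδE, hCE, hE⟩ := decays_E2 (d := d) (Lc := Lc) (j + 1)
    set n : ℝ := min δA δE with hn
    have hn0 : 0 < n := lt_min hδA hδE
    have hA' : Decays (KInvStep (d := d) Lc (j + 1)) CA n := decays_mono hA hCA le_rfl (min_le_left _ _)
    have hE' : Decays (E2 d Lc (j + 1)) CE n := decays_mono hE hCE le_rfl (min_le_right _ _)
    have hc := abs_lamCoeffK_le hA' hE' hn0 Lc
    have hn2 : (0 : ℝ) ≤ n / 2 := by positivity
    have hQ : VertexFamily (fun μ y => hessFFAt (toSite r) Lc μ y) Lc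
        (2 * (ell (d + 1) Lc : ℝ) ^ 2 * Real.exp (4 * ((d : ℝ) + 1) * Lc * (n / 2))) (n / 2) :=
      fun μ y => biLoc_hessFFAt hLc μ y hr hn2
    have h3 := locStencil_SLam (N := Lc) hc hQ (by positivity)
      (mul_nonneg (mul_nonneg (Nat.cast_nonneg _) (mul_nonneg hCA hCE)) (Zl_nonneg (by linarith)))
    set r' : ℝ := min δ₁ (n / 2 / 2) with hr'
    have hr0 : 0 < r' := lt_min hδ₁ (by positivity)
    have hC₁ : 0 ≤ C₁ := (h1 0 0).nonneg (Sum.inl 0)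
    have h1r : LocStencil (e3OfK Lc (coDressKBmAt (toSite r) Lc (KInvStep (d := d) Lc j)) (SrecAt d Lc (toSite r) cE cVH cΛ j)) C₁ r' :=
      locStencil_mono h1 hC₁ (min_le_left _ _)
    have h2r : LocStencil (vhSAt (toSite r) d Lc rfl)
        (3 * (ell (d + 1) Lc : ℝ) ^ 2 * Real.exp (4 * ((d : ℝ) + 1) * Lc * r')) r' := locStencil_vhSAt hLc hr hr0.le
    have h3r := locStencil_mono h3 ((h3 0 0).nonneg (Sum.inl 0)) (min_le_right δ₁ (n / 2 / 2))
    exact ⟨_, r', hr0, fun κ' u' => by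
      rw [SrecAt_succ]
      exact (locStencil_add (locStencil_add (locStencil_smul (cE * wE d Lc (j + 1)) h1r)
        (locStencil_smul (cVH * wVH d Lc (j + 1)) h2r)) (locStencil_smul (cΛ * wΛ d Lc (j + 1)) h3r)) κ' u'⟩

/-- [folklore] **(St) FOR EVERY MEMBER OF `SrecAt ρ`** (block translations `u ↦ u + Lc•t`, any root): member `0` by `S0NAt_translate`, member
`j+1` by an2's `e3OfK_translate` (`G_j` is `Lc`-translation invariant: `shiftK_coDressKBmAt_KInvStep`) + `vhSAt_translate` + `SLam_translate`. -/
theorem SrecAt_translate (ρ : Fin (d + 1) → ℤ) (hLc : 1 ≤ Lc) (cE cVH cΛ : ℝ) :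
    ∀ (j : ℕ) (κ' : Fin (d + 1)) (u t : Fin (d + 1) → ℤ),
      SrecAt d Lc ρ cE cVH cΛ j κ' (u + (Lc : ℤ) • t) = shiftK (-((Lc : ℤ) • t)) (SrecAt d Lc ρ cE cVH cΛ j κ' u)
  | 0, κ', u, t => S0NAt_translate ρ hLc cE cVH cΛ κ' u t
  | j + 1, κ', u, t => by
    have h1 := e3OfK_translate (N := Lc) (K := coDressKBmAt ρ Lc (KInvStep (d := d) Lc j))
      (shiftK_coDressKBmAt_KInvStep (d := d) ρ j) (S := SrecAt d Lc ρ cE cVH cΛ j) (SrecAt_translate ρ hLc cE cVH cΛ j) κ' u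
      ((Lc : ℤ) • t)
    have h2 := vhSAt_translate (d := d) ρ hLc κ' u t
    have h3 := SLam_translate (N := Lc) (c := lamCoeffK (KInvStep (d := d) Lc (j + 1)) (E2 d Lc (j + 1)) Lc)
      (Q2 := fun μ y => hessFFAt ρ Lc μ y)
      (fun μ y κ'' u' t' => lamCoeffK_translate (fun s => shiftK_KInvStep (d := d) (Lc := Lc) (j + 1) s)
        (fun s => shiftK_E2 (d := d) (Lc := Lc) (j + 1) _) μ y κ'' u' t')
      (fun μ y t' => hessFFAt_translate ρ μ y t') κ' u t
    funext x z a b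
    simp only [SrecAt_succ, Pi.add_apply, Pi.smul_apply, smul_eq_mul, shiftK]
    rw [h1, h2, h3]
    rfl

end Local

/-! ## §3 The divergence of a member has exactly a cubic and a border sector (the recursion hypothesis `hT`) -/

section Divergence

variable {Lc : ℕ} [NeZero Lc]

/-- [folklore] **THE DIVERGENCE OF MEMBER `j+1` HAS NO Λ-PART** (in-block root; leaf-10's `divV_SLam_lamCoeffK_E2_eq_zero` with
`A := KInvStep Lc (j+1)`): `divV (SrecAt ρ … (j+1)) u = (cE·wE (j+1)) • divV (e3K G_j Lc (SrecAt ρ … j)) u + (cVH·wVH (j+1)) • divV (vhSAt ρ) u`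
— LITERALLY the recursion hypothesis `hT` of `WardLocusInduction.hSd_wall_all_S0NAt` with `a (j+1) = cE·wE (j+1)`, `b (j+1) = cVH·wVH (j+1)`. -/
theorem divV_SrecAt_succ (hLc : 1 ≤ Lc) {r : Fin (d + 1) → ℕ} (hr : r ∈ box (d + 1) Lc) (cE cVH cΛ : ℝ) (j : ℕ)
    (u : Fin (d + 1) → ℤ) :
    divV (SrecAt d Lc (toSite r) cE cVH cΛ (j + 1)) u =
      (cE * wE d Lc (j + 1)) •
          divV (e3K (coDressKBmAt (toSite r) Lc (KInvStep (d := d) Lc j)) Lc (SrecAt d Lc (toSite r) cE cVH cΛ j)) u +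
        (cVH * wVH d Lc (j + 1)) • divV (vhSAt (toSite r) d Lc) u := by
  obtain ⟨δA, CA, hδA, hCA, hA⟩ := decays_KInvStep (Lc := Lc) (d := d) (j + 1)
  have hQ : VertexFamily (fun μ y => hessFFAt (toSite r) Lc μ y) Lc (2 * (ell (d + 1) Lc : ℝ) ^ 2 * Real.exp (4 * ((d : ℝ) + 1) * Lc * δA)) δA :=
    fun μ y => biLoc_hessFFAt hLc μ y hr hδA.le
  have hΛ := divV_SLam_lamCoeffK_E2_eq_zero (Lc := Lc) (N := Lc) (j + 1) hA hδA hQ hδA u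
  rw [← e3OfK_eq_e3K]
  funext x z a b
  have hΛ' := congr_fun (congr_fun (congr_fun (congr_fun hΛ x) z) a) b
  simp only [divV_apply, Pi.zero_apply, Finset.sum_sub_distrib] at hΛ'
  simp only [divV_apply, Pi.add_apply, Pi.smul_apply, smul_eq_mul, SrecAt_succ, Finset.sum_add_distrib, Finset.sum_sub_distrib,
    ← Finset.mul_sum]
  linear_combination (cΛ * wΛ d Lc (j + 1)) * hΛ'

end Divergence

/-! ## §4 THE hW FIRST-ORDER SOCKET OF `SrecAt` AT EVERY LEVEL, AT THE PINNED UNITS -/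

section Socket

variable {Lc : ℕ} [NeZero Lc]

/-- [folklore] **`hSd` AT EVERY LEVEL FOR THE RECURSIVE CANDIDATE FAMILY, ON THE WARD PIN.**  For `Lc ≥ 1`, an in-block root `ρ = toSite r`,
ANY `cE ≠ 0` with `cE = Lc^{d+1}` and `cVH = −cE·(1/2)·Lc^{d+1}` (the hR hyperplane `2·cVH = −cE·Lc^{d+1}` at the Ward pin of
`WardLocusInduction.stepLocks_bcj_iff`; Wilson constant `1/2` from leaf-05), and ANY Λ-weight `cΛ`: with the CONSTANT generator scale
`ξ = cE·(1/2)/Lc^{d+1}` and leaf-07's `cH j = (stepScale j·Lc^{d+1})⁻¹`,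
`∀ j y, cH j • Σ_{v ∈ box} divV (SrecAt ρ cE cVH cΛ j) (Lc•y + v) = conjV (bhKStepAt d ρ Lc j) (diagK (ξ • Σ_v legInd ρ (Lc•y + v)))` — NO hypothesis on
the S-side is left: `WardLocusInduction.hSd_wall_all_S0NAt` with `hT := divV_SrecAt_succ`, `hX :=` an1's `loc_diagK_smul_sum_legInd`, the
locks by `stepLocks_bcj_iff`. -/
theorem hSd_SrecAt_of_pin (hLc : 1 ≤ Lc) {r : Fin (d + 1) → ℕ} (hr : r ∈ box (d + 1) Lc) {cE cVH : ℝ} (cΛ : ℝ)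
    (hcE : cE = (Lc : ℝ) ^ (d + 1)) (hcVH : cVH = -(cE * (1 / 2) * (Lc : ℝ) ^ (d + 1))) :
    ∀ (j : ℕ) (y : Fin (d + 1) → ℤ),
      (stepScale d Lc j * (Lc : ℝ) ^ (d + 1))⁻¹ • ∑ v ∈ box (d + 1) Lc, divV (SrecAt d Lc (toSite r) cE cVH cΛ j) ((Lc : ℤ) • y + toSite v) =
        conjV (bhKStepAt d (toSite r) Lc j)
          (diagK ((cE * (1 / 2) / (Lc : ℝ) ^ (d + 1)) • ∑ v ∈ box (d + 1) Lc, legInd (toSite r) ((Lc : ℤ) • y + toSite v))) := by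
  have hL : (Lc : ℝ) ^ (d + 1) ≠ 0 := pow_ne_zero _ (by exact_mod_cast NeZero.ne Lc)
  have hc : cE * (1 / 2) ≠ 0 := by rw [hcE]; exact mul_ne_zero hL (by norm_num)
  -- the scalar locks at every step, from the pin (`stepLocks_bcj_iff`, ← direction) with the constant scale sequence
  have hlocks := (stepLocks_bcj_iff (d := d) (Lc := Lc) hc (ξ := fun _ => cE * (1 / 2) / (Lc : ℝ) ^ (d + 1)) rfl hcVH).2
    ⟨fun _ => rfl, hcE⟩
  refine hSd_wall_all_S0NAt hLc hr cE cVH cΛ (S := SrecAt d Lc (toSite r) cE cVH cΛ) (SrecAt_zero _ _ _ _)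
    (Cs := fun j => Classical.choose (locStencil_SrecAt hLc hr cE cVH cΛ j))
    (δs := fun j => Classical.choose (Classical.choose_spec (locStencil_SrecAt hLc hr cE cVH cΛ j)))
    (fun j => (Classical.choose_spec (Classical.choose_spec (locStencil_SrecAt hLc hr cE cVH cΛ j))).2)
    (fun j => (Classical.choose_spec (Classical.choose_spec (locStencil_SrecAt hLc hr cE cVH cΛ j))).1)
    (ξ := fun _ => cE * (1 / 2) / (Lc : ℝ) ^ (d + 1)) (a := fun j => cE * wE d Lc j) (b := fun j => cVH * wVH d Lc j)
    (fun _ y => loc_diagK_smul_sum_legInd Lc (toSite r) _ y) (fun j u => divV_SrecAt_succ hLc hr cE cVH cΛ j u) ?_ ?_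
    (fun j => (hlocks j).1) (fun j => (hlocks j).2)
  · rw [stepScale_zero, one_mul]; field_simp
  · rw [stepScale_zero, one_mul, hcVH]; field_simp

/-- [folklore] **THE PINNED INSTANCE WITH NO HYPOTHESIS AT ALL**: at `(cE, cVH) = (Lc^{d+1}, −Lc^{d+1}·(1/2)·Lc^{d+1})`, every Λ-weight `cΛ`,
every in-block root, every `d`, `Lc ≥ 1`: the hW root's first-order socket `hSd` holds AT EVERY LEVEL for `SrecAt` with generator scale `1/2`:
`∀ j y, (stepScale j·Lc^{d+1})⁻¹ • Σ_{v ∈ box} divV (SrecAt ρ … j) (Lc•y + v) = conjV (bhKStepAt d ρ Lc j) (diagK ((1/2) • Σ_v legInd ρ (Lc•y + v)))`. -/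
theorem hSd_SrecAt (hLc : 1 ≤ Lc) {r : Fin (d + 1) → ℕ} (hr : r ∈ box (d + 1) Lc) (cΛ : ℝ) (j : ℕ) (y : Fin (d + 1) → ℤ) :
    (stepScale d Lc j * (Lc : ℝ) ^ (d + 1))⁻¹ •
        ∑ v ∈ box (d + 1) Lc, divV (SrecAt d Lc (toSite r) ((Lc : ℝ) ^ (d + 1))
          (-((Lc : ℝ) ^ (d + 1) * (1 / 2) * (Lc : ℝ) ^ (d + 1))) cΛ j) ((Lc : ℤ) • y + toSite v) =
      conjV (bhKStepAt d (toSite r) Lc j) (diagK (((1 : ℝ) / 2) • ∑ v ∈ box (d + 1) Lc, legInd (toSite r) ((Lc : ℤ) • y + toSite v))) := by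
  have hL : (Lc : ℝ) ^ (d + 1) ≠ 0 := pow_ne_zero _ (by exact_mod_cast NeZero.ne Lc)
  have h := hSd_SrecAt_of_pin (d := d) hLc hr (cE := (Lc : ℝ) ^ (d + 1)) (cVH := -((Lc : ℝ) ^ (d + 1) * (1 / 2) * (Lc : ℝ) ^ (d + 1)))
    cΛ rfl rfl j y
  rwa [show (Lc : ℝ) ^ (d + 1) * (1 / 2) / (Lc : ℝ) ^ (d + 1) = 1 / 2 by field_simp] at h

end Socket

end Summit.QuantumFields.BalabanUV.Beta.WardLocusRecursive

end
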